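import Summits.AtomisticToContinuum.FouriersLaw.Theorems.BondHeatUncertaintyBoundedResponseHeatSpreadingA

/-!
# NODE 104 «HeatSpreading» — part B of 3 (sequel of `…HeatSpreadingA`, whose module docstring describes the node): §5 the graded `N`-uniform pieces, §6 real-exponent bookkeeping, §7 the free rungs, §8 ladder monotonicity and window ⟹ point

Split for the 400-line cap by the landing lane (hand-2 g38) — 3-way cut A (l.1–305) / B (l.312–558) / C (l.559–776) approved by critic row 1440 (B); same namespace
`…Theorems.BoundedResponse.HeatSpreading` and opens throughout; all FQNs unchanged; bodies verbatim; lane docstrings / private twins announced on the bus.  0 sorry; standard axioms.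
-/

noncomputable section

open MeasureTheory ProbabilityTheory Filter Topology Set Function
open scoped NNReal ENNReal
open Literature.MathematicalPhysics.KineticTheory.HeatConduction
open Literature.MathematicalPhysics.KineticTheory OscillatorChain
open Summit.AtomisticToContinuum.FouriersLaw.Theorems.SubdiffusiveBondHeat
open Summit.AtomisticToContinuum.FouriersLaw.Theorems.SubdiffusiveBondHeat.EscapeGrading
open Summit.AtomisticToContinuum.FouriersLaw.Theorems.OddSectorIrreversibility

namespace Summit.AtomisticToContinuum.FouriersLaw.Theorems.BoundedResponse.HeatSpreading

open Summit.AtomisticToContinuum.FouriersLaw.Theses.BondHeatUncertainty (BoundedResponse SubdiffusiveBondHeat)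
open Summit.AtomisticToContinuum.FouriersLaw.Theorems.BoundedResponse.TransientBand (integral_min_mul_eq_sub)
open Summit.AtomisticToContinuum.FouriersLaw.Theorems.LightConeBondHeat (pinnedChain_autocorr_abs_le)
open Summit.AtomisticToContinuum.FouriersLaw.Theorems.BoundedResponse.TransientContact (gibbsBondHeatVar gibbsBondCorr)
open Summit.AtomisticToContinuum.FouriersLaw.Theorems.BoundedResponse.ParityFloor (exists_integral_totalCurrent_sq_gibbsMeasure_le)

/-! ## §5 The graded `N`-uniform pieces -/

/-- **(HSᵂ_b) `HeatSpreadWindow b`** — SPREADING EXPONENT `b` up to the Thouless time: `∃ C, c > 0, N₀: ∀ N ≥ N₀, ∀ t ∈ [1, cN²],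
V_N(t) ≤ C·N·t^b`.  `b = 2` PROVED (`heatSpreadWindow_two`, kernel contraction: the ballistic bound); `b = 1` NORMAL HEAT SPREADING (the
energy-centroid mean-square displacement grows linearly in `t` and `N` before the baths are felt; bulk energy diffusion), phonon-FALSE
(`V_N^{harm}(t) ≍ N t²` for `t ≲ N`); `1 < b < 2` superdiffusive spreading.  Why it might fail (`b = 1`): a ballistic or Lévy channel of
the anharmonic pinned bulk at some temperature.  Tags: UNDECIDED (`b < 2`) · IDEA-NEEDED · ⟹ (HSᴾ_{1+2b}). [route statement · this cell] -/
def HeatSpreadWindow (b : ℝ) : Prop :=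
  ∀ ω₂ lam β γ : ℝ, 0 < ω₂ → 0 < lam → 0 < β → 0 < γ → ∀ T : ℝ, 0 < T →
    ∃ C c : ℝ, 0 < c ∧ ∃ N₀ : ℕ, ∀ N : ℕ, N₀ ≤ N → ∀ t : ℝ, 1 ≤ t → t ≤ c * (N : ℝ) ^ 2 →
      heatSpread ω₂ lam β γ T N t ≤ C * (N : ℝ) * t ^ b

/-- **(HSᴾ_h) `HeatSpreadPoint h`** — the heat spreading AT THE THOULESS TIME: `∃ C, c > 0, N₀: ∀ N ≥ N₀, V_N(cN²) ≤ C·N^h`.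
`h = 5` PROVED (`heatSpreadPoint_five`); `h = 3` is the normal grade: with (TCᶜ_3) it gives 11071
(`boundedResponse_of_heatSpreadPoint_gkTailCeiling_three`), and 11071 ∧ (TFᶜ_3) give it back
(`heatSpreadPoint_three_of_boundedResponse_gkTailFloor`); it follows from the (S) branch modulo (TBC)
(`heatSpreadPoint_three_of_subdiffusive_comparison`).  Tags (`h = 3`): UNDECIDED · phonon-FALSE (`V_N^{harm}(cN²) ≍ N⁴`) · ≡ 11071 modulo
(TFᶜ_3). [route statement · this cell] -/
def HeatSpreadPoint (h : ℝ) : Prop :=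
  ∀ ω₂ lam β γ : ℝ, 0 < ω₂ → 0 < lam → 0 < β → 0 < γ → ∀ T : ℝ, 0 < T →
    ∃ C c : ℝ, 0 < c ∧ ∃ N₀ : ℕ, ∀ N : ℕ, N₀ ≤ N →
      heatSpread ω₂ lam β γ T N (c * (N : ℝ) ^ 2) ≤ C * (N : ℝ) ^ h

/-- **(HSᵁ) `HeatSpreadUniform`** — uniformly normal heat spreading at ALL times: `∃ C N₀: ∀ N ≥ N₀, ∀ t ≥ 1, V_N(t) ≤ C·N·t`.  The top of
the ladder: ⟹ 11071 with NO transient piece (`boundedResponse_of_heatSpreadUniform`, Einstein–Helfand = Green–Kubo at fixed `N`).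
Tags: UNDECIDED · phonon-FALSE · STRONGER-LEANING (= 11071 plus a floor on `Tr_N(t)` at every `t`). [route statement · this cell] -/
def HeatSpreadUniform : Prop :=
  ∀ ω₂ lam β γ : ℝ, 0 < ω₂ → 0 < lam → 0 < β → 0 < γ → ∀ T : ℝ, 0 < T →
    ∃ C : ℝ, ∃ N₀ : ℕ, ∀ N : ℕ, N₀ ≤ N → ∀ t : ℝ, 1 ≤ t →
      heatSpread ω₂ lam β γ T N t ≤ C * (N : ℝ) * t

/-- **(TCᶜ_g) `GKTailCeiling g`** — the Green–Kubo TAIL CEILING at the Thouless time: `∀ c > 0 ∃ C N₀ ∀ N ≥ N₀, Tr_N(cN²) ≤ C·N^g`, i.e.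
`∫₀^{cN²} (G_N − ∫₀ʳ C_N) dr ≤ C N^g`: the running Green–Kubo integral of the open chain does not stay BELOW its saturation value by
more than `O(N^{g−2})` on average over the Thouless window (no late surge of conductance).  `g = 4` PROVED (`gkTailCeiling_four`, the
conductance cap `G_N ≤ γT²(N−1)²`); **`g = 3` is IMPLIED BY 11071** (`gkTailCeiling_three_of_boundedResponse`, the free sign `V_N ≥ 0`).
Expected TRUE for phonons (`Tr_N^{harm}(cN²) ≍ N³`).  Why it matters: given the (S) branch and (TBC), 11071 ⟺ (TCᶜ_3)
(`boundedResponse_iff_gkTailCeiling_three_of_subdiffusive_comparison`).  Tags (`g = 3`): UNDECIDED · NECESSARY for 11071 (proved) ·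
phonon-compatible · INSTRUMENTABLE (equilibrium MD of `C_N`). [route statement · this cell] -/
def GKTailCeiling (g : ℝ) : Prop :=
  ∀ ω₂ lam β γ : ℝ, 0 < ω₂ → 0 < lam → 0 < β → 0 < γ → ∀ T : ℝ, 0 < T → ∀ c : ℝ, 0 < c →
    ∃ C : ℝ, ∃ N₀ : ℕ, ∀ N : ℕ, N₀ ≤ N →
      gkTail ω₂ lam β γ T N (c * (N : ℝ) ^ 2) ≤ C * (N : ℝ) ^ g

/-- **(TFᶜ_g) `GKTailFloor g`** — the Green–Kubo TAIL FLOOR at the Thouless time: `∀ c > 0 ∃ C N₀ ∀ N ≥ N₀, Tr_N(cN²) ≥ −C·N^g`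
(no overshoot of the running Green–Kubo integral ABOVE its saturation value by more than `O(N^{g−2})` on average).  `g = 5` PROVED
(`gkTailFloor_five`, `G_N ≥ 0` and `V_N ≤ ‖J‖²t²`); `g = 3` is the Einstein–Helfand twin of `TransientBand.TransientFloor 1`: with 11071 it
returns (HSᴾ_3).  Tags (`g = 3`): UNDECIDED · TRUE for phonons in evidence · not known to follow from 11071. [route statement · this cell] -/
def GKTailFloor (g : ℝ) : Prop :=
  ∀ ω₂ lam β γ : ℝ, 0 < ω₂ → 0 < lam → 0 < β → 0 < γ → ∀ T : ℝ, 0 < T → ∀ c : ℝ, 0 < c →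
    ∃ C : ℝ, ∃ N₀ : ℕ, ∀ N : ℕ, N₀ ≤ N →
      -(C * (N : ℝ) ^ g) ≤ gkTail ω₂ lam β γ T N (c * (N : ℝ) ^ 2)

/-- **(TBC) `TotalBondComparison`** — fixed-`N` telescoping of the total current onto ONE bond: `∃ C ∀ N, ∀ b (b+1 < N), ∀ t ≥ 0,
V_N(t) ≤ 2(N−1)²·V_N(b,t) + C·N³` with `V_N(b,t)` the single-bond heat variance of the (S) items (`TransientContact.gibbsBondHeatVar`,
VERBATIM the `let V` of `SubdiffusiveBondHeat`).  Mechanism: `∫₀ᵗ J = (N−1)∫₀ᵗ j_b + (F_b(z_0) − F_b(z_t))`, `F_b = ∑_i ±E_{(i,b]}` a weighted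
sum of INTERIOR block energies (pathwise energy balance, bath terms cancel), `E(F_b(z_t) − F_b(z_0))² ≤ 4Var_{μ_T}F_b ≤ 16(N·√(C_W N))²`
by the PROVED `extensiveBlockEnergyVariance_holds`.  Tags: WEAKER (TRUE at every fixed `N`, harmonic included) · fixed-`N` ·
ATTACKABLE·M (interior pathwise balance along `solMap`, then `pinnedChain_integral_sq_intervalIntegral_of_invariant`). [route statement · this cell] -/
def TotalBondComparison : Prop :=
  ∀ ω₂ lam β γ : ℝ, 0 < ω₂ → 0 < lam → 0 < β → 0 < γ → ∀ T : ℝ, 0 < T →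
    ∃ C : ℝ, ∀ N b : ℕ, b + 1 < N → ∀ t : ℝ, 0 ≤ t →
      heatSpread ω₂ lam β γ T N t ≤
        2 * ((N : ℝ) - 1) ^ 2 * gibbsBondHeatVar (pinnedChain ω₂ lam β γ) T N b t + C * (N : ℝ) ^ 3

section Ladder

variable {ω₂ lam β γ T : ℝ}

/-! ## §6 Real-exponent bookkeeping -/

/-- `x ^ (3:ℝ) = x ^ 3` (`rpow_three`; docstring added by the landing lane — the gate lints private declarations too). [formal bookkeeping] -/
private theorem rpow_three (x : ℝ) : x ^ (3 : ℝ) = x ^ 3 := by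
  rw [show (3 : ℝ) = ((3 : ℕ) : ℝ) by norm_num, Real.rpow_natCast]

/-- `x ^ (4:ℝ) = x ^ 4` (`rpow_four`; docstring added by the landing lane — the gate lints private declarations too). [formal bookkeeping] -/
private theorem rpow_four (x : ℝ) : x ^ (4 : ℝ) = x ^ 4 := by
  rw [show (4 : ℝ) = ((4 : ℕ) : ℝ) by norm_num, Real.rpow_natCast]

/-- `x ^ (5:ℝ) = x ^ 5` (`rpow_five`; docstring added by the landing lane — the gate lints private declarations too). [formal bookkeeping] -/
private theorem rpow_five (x : ℝ) : x ^ (5 : ℝ) = x ^ 5 := by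
  rw [show (5 : ℝ) = ((5 : ℕ) : ℝ) by norm_num, Real.rpow_natCast]

/-- `x ^ (2:ℝ) = x ^ 2` (`rpow_two'`; docstring added by the landing lane — the gate lints private declarations too). [formal bookkeeping] -/
private theorem rpow_two' (x : ℝ) : x ^ (2 : ℝ) = x ^ 2 := by
  rw [show (2 : ℝ) = ((2 : ℕ) : ℝ) by norm_num, Real.rpow_natCast]

/-- From `c N² G_N ≤ K N^m` (`K ≥ 0`, `c > 0`, `N ≥ 2`) to the escape rung `E_N ≤ (4K/(cγT²))/N^{4−m}` (`G_N = γT²(N−1)²E_N`,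
`N² ≤ 4(N−1)²`). [folklore] -/
theorem escapeDeficit_le_of_totalGK_le (hω : 0 < ω₂) (hl : 0 < lam) (hβ : 0 < β) (hγ : 0 < γ) (hT : 0 < T)
    {N : ℕ} (hN : 2 ≤ N) {K m c : ℝ} (hK : 0 ≤ K) (hc : 0 < c)
    (h : c * (N : ℝ) ^ 2 * totalGK ω₂ lam β γ T N ≤ K * (N : ℝ) ^ m) :
    escapeDeficit ω₂ lam β γ T N ≤ (4 * K / (c * γ * T ^ 2)) / (N : ℝ) ^ (4 - m) := by
  have hN2 : (2 : ℝ) ≤ N := by exact_mod_cast hN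
  have hNpos : (0 : ℝ) < N := by linarith
  have hN1 : (0 : ℝ) < (N : ℝ) - 1 := by linarith
  have hG := totalGK_eq hω hl hβ hγ hT (show 0 < N by omega)
  set x : ℝ := (N : ℝ) with hx
  set G := totalGK ω₂ lam β γ T N with hGdef
  set E := escapeDeficit ω₂ lam β γ T N with hE
  have hden : 0 < γ * T ^ 2 * (x - 1) ^ 2 := by positivity
  have hEeq : E = G / (γ * T ^ 2 * (x - 1) ^ 2) := by
    rw [hG]; field_simp
  have hxm : 0 < x ^ m := Real.rpow_pos_of_pos hNpos m
  have hx4 : x ^ (4 - m) = x ^ 4 / x ^ m := by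
    rw [Real.rpow_sub hNpos, rpow_four]
  rw [hEeq, hx4, div_div_eq_mul_div, div_le_div_iff₀ hden (by positivity)]
  -- goal: `G · x⁴ ≤ (4K/(cγT²))·x^m·(γT²(x−1)²)`; key: `c·G·x⁴ ≤ 4K x^m (x−1)²`
  have key : c * (G * x ^ 4) ≤ 4 * K * x ^ m * (x - 1) ^ 2 := by
    have h1 : c * (G * x ^ 4) = x ^ 2 * (c * x ^ 2 * G) := by ring
    rw [h1]
    have h2 := mul_le_mul_of_nonneg_left h (sq_nonneg x)
    have h3 : x ^ 2 ≤ 4 * (x - 1) ^ 2 := by nlinarith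
    have hKx : 0 ≤ K * x ^ m := mul_nonneg hK hxm.le
    calc x ^ 2 * (c * x ^ 2 * G) ≤ x ^ 2 * (K * x ^ m) := h2
      _ ≤ 4 * (x - 1) ^ 2 * (K * x ^ m) := mul_le_mul_of_nonneg_right h3 hKx
      _ = 4 * K * x ^ m * (x - 1) ^ 2 := by ring
  have hc0 : c ≠ 0 := hc.ne'
  have hγ0 : γ ≠ 0 := hγ.ne'
  have hT0 : T ≠ 0 := hT.ne'
  calc G * x ^ 4 = c * (G * x ^ 4) / c := by field_simp
    _ ≤ 4 * K * x ^ m * (x - 1) ^ 2 / c := div_le_div_of_nonneg_right key hc.le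
    _ = 4 * K / (c * γ * T ^ 2) * x ^ m * (γ * T ^ 2 * (x - 1) ^ 2) := by field_simp

/-! ## §7 The free rungs: `b = 2`, `h = 5`, `g = 4` (ceiling), `g = 5` (floor) -/

/-- **(HSᵂ_2) PROVED** — the ballistic bound `V_N(t) ≤ ‖J‖²_{μ_T} t² ≤ C_J N t²` (`c = 1`, `N ≥ 1`). [folklore] -/
theorem heatSpreadWindow_two : HeatSpreadWindow 2 := by
  intro ω₂ lam β γ hω hl hβ hγ T hT
  obtain ⟨CJ, hCJ0, hJ⟩ := exists_integral_totalCurrent_sq_gibbsMeasure_le (γ := γ) hω hl hβ hT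
  refine ⟨CJ, 1, one_pos, 1, fun N hN t ht _ => ?_⟩
  have hN0 : 0 < N := by omega
  have hV := heatSpread_le_normSq_mul_sq hω hl hβ hγ hT hN0 (by linarith : (0 : ℝ) ≤ t)
  rw [rpow_two']
  calc heatSpread ω₂ lam β γ T N t ≤ _ := hV
    _ ≤ CJ * (N : ℝ) * t ^ 2 := mul_le_mul_of_nonneg_right (hJ N) (sq_nonneg t)

/-- **(HSᴾ_5) PROVED** — `V_N(N²) ≤ C_J N⁵` (`c = 1`). [folklore] -/
theorem heatSpreadPoint_five : HeatSpreadPoint 5 := by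
  intro ω₂ lam β γ hω hl hβ hγ T hT
  obtain ⟨CJ, hCJ0, hJ⟩ := exists_integral_totalCurrent_sq_gibbsMeasure_le (γ := γ) hω hl hβ hT
  refine ⟨CJ, 1, one_pos, 1, fun N hN => ?_⟩
  have hN0 : 0 < N := by omega
  have hV := heatSpread_le_normSq_mul_sq hω hl hβ hγ hT hN0 (t := 1 * (N : ℝ) ^ 2) (by positivity)
  rw [rpow_five]
  calc heatSpread ω₂ lam β γ T N (1 * (N : ℝ) ^ 2) ≤ _ := hV
    _ ≤ CJ * (N : ℝ) * (1 * (N : ℝ) ^ 2) ^ 2 := mul_le_mul_of_nonneg_right (hJ N) (sq_nonneg _)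
    _ = CJ * (N : ℝ) ^ 5 := by ring

/-- **(TCᶜ_4) PROVED** — `Tr_N(cN²) ≤ cN²·G_N ≤ cγT²·N⁴` (the conductance cap `G_N ≤ γT²(N−1)²`, `N ≥ 2`). [folklore] -/
theorem gkTailCeiling_four : GKTailCeiling 4 := by
  intro ω₂ lam β γ hω hl hβ hγ T hT c hc
  refine ⟨c * γ * T ^ 2, 2, fun N hN => ?_⟩
  have hN0 : 0 < N := by omega
  have hNr : (2 : ℝ) ≤ N := by exact_mod_cast hN
  have ht : (0 : ℝ) ≤ c * (N : ℝ) ^ 2 := by positivity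
  have h1 := gkTail_le hω hl hβ hγ hT hN0 ht
  obtain ⟨hG0, hG1⟩ := totalGK_nonneg_and_le hω hl hβ hγ hT hN
  rw [rpow_four]
  have h2 : ((N : ℝ) - 1) ^ 2 ≤ (N : ℝ) ^ 2 := by nlinarith
  calc gkTail ω₂ lam β γ T N (c * (N : ℝ) ^ 2) ≤ c * (N : ℝ) ^ 2 * totalGK ω₂ lam β γ T N := h1
    _ ≤ c * (N : ℝ) ^ 2 * (γ * T ^ 2 * ((N : ℝ) - 1) ^ 2) := mul_le_mul_of_nonneg_left hG1 (by positivity)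
    _ ≤ c * (N : ℝ) ^ 2 * (γ * T ^ 2 * (N : ℝ) ^ 2) := by gcongr
    _ = c * γ * T ^ 2 * (N : ℝ) ^ 4 := by ring

/-- **(TFᶜ_5) PROVED** — `Tr_N(cN²) ≥ cN²·G_N − ‖J‖²(cN²)²/2 ≥ −(C_J c²/2)·N⁵` (`G_N ≥ 0`, `V_N ≤ ‖J‖²t²`, `N ≥ 2`). [folklore] -/
theorem gkTailFloor_five : GKTailFloor 5 := by
  intro ω₂ lam β γ hω hl hβ hγ T hT c hc
  obtain ⟨CJ, hCJ0, hJ⟩ := exists_integral_totalCurrent_sq_gibbsMeasure_le (γ := γ) hω hl hβ hT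
  refine ⟨CJ * c ^ 2 / 2, 2, fun N hN => ?_⟩
  have hN0 : 0 < N := by omega
  have ht : (0 : ℝ) ≤ c * (N : ℝ) ^ 2 := by positivity
  have h1 := mul_totalGK_sub_le_gkTail hω hl hβ hγ hT hN0 ht
  obtain ⟨hG0, -⟩ := totalGK_nonneg_and_le hω hl hβ hγ hT hN
  rw [rpow_five]
  have hJN := hJ N
  have h3 : 0 ≤ (c * (N : ℝ) ^ 2) ^ 2 / 2 := by positivity
  have h4 : (∫ z, (∑ i : Fin N, (pinnedChain ω₂ lam β γ).bondCurrent N i z) ^ 2 ∂((pinnedChain ω₂ lam β γ).gibbsMeasure N T)) *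
      (c * (N : ℝ) ^ 2) ^ 2 / 2 ≤ CJ * (N : ℝ) * ((c * (N : ℝ) ^ 2) ^ 2 / 2) := by
    rw [mul_div_assoc]
    exact mul_le_mul_of_nonneg_right hJN h3
  have h5 : 0 ≤ c * (N : ℝ) ^ 2 * totalGK ω₂ lam β γ T N := mul_nonneg ht hG0
  calc -(CJ * c ^ 2 / 2 * (N : ℝ) ^ 5) = 0 - CJ * (N : ℝ) * ((c * (N : ℝ) ^ 2) ^ 2 / 2) := by ring
    _ ≤ c * (N : ℝ) ^ 2 * totalGK ω₂ lam β γ T N -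
        (∫ z, (∑ i : Fin N, (pinnedChain ω₂ lam β γ).bondCurrent N i z) ^ 2 ∂((pinnedChain ω₂ lam β γ).gibbsMeasure N T)) *
          (c * (N : ℝ) ^ 2) ^ 2 / 2 := by linarith
    _ ≤ gkTail ω₂ lam β γ T N (c * (N : ℝ) ^ 2) := h1

/-! ## §8 Ladder monotonicity and window ⟹ point -/

/-- Larger `h` is weaker: `h ≤ h' ⟹ (HSᴾ_h) ⟹ (HSᴾ_{h'})` (`N^h ≤ N^{h'}` for `N ≥ 1`). [folklore] -/
theorem heatSpreadPoint_mono {h h' : ℝ} (hh : h ≤ h') : HeatSpreadPoint h → HeatSpreadPoint h' := by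
  intro hP ω₂ lam β γ hω hl hβ hγ T hT
  obtain ⟨C, c, hc, N₀, hC⟩ := hP ω₂ lam β γ hω hl hβ hγ T hT
  refine ⟨max C 0, c, hc, max N₀ 1, fun N hN => ?_⟩
  have hN₀ : N₀ ≤ N := le_trans (le_max_left _ _) hN
  have hN1 : (1 : ℝ) ≤ N := by exact_mod_cast le_trans (le_max_right _ _) hN
  have hp : (0 : ℝ) ≤ (N : ℝ) ^ h := Real.rpow_nonneg (by linarith) h
  calc heatSpread ω₂ lam β γ T N (c * (N : ℝ) ^ 2) ≤ C * (N : ℝ) ^ h := hC N hN₀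
    _ ≤ max C 0 * (N : ℝ) ^ h := mul_le_mul_of_nonneg_right (le_max_left _ _) hp
    _ ≤ max C 0 * (N : ℝ) ^ h' :=
        mul_le_mul_of_nonneg_left (Real.rpow_le_rpow_of_exponent_le hN1 hh) (le_max_right _ _)

/-- Larger `g` is weaker: `g ≤ g' ⟹ (TCᶜ_g) ⟹ (TCᶜ_{g'})`. [folklore] -/
theorem gkTailCeiling_mono {g g' : ℝ} (hg : g ≤ g') : GKTailCeiling g → GKTailCeiling g' := by
  intro hP ω₂ lam β γ hω hl hβ hγ T hT c hc
  obtain ⟨C, N₀, hC⟩ := hP ω₂ lam β γ hω hl hβ hγ T hT c hc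
  refine ⟨max C 0, max N₀ 1, fun N hN => ?_⟩
  have hN₀ : N₀ ≤ N := le_trans (le_max_left _ _) hN
  have hN1 : (1 : ℝ) ≤ N := by exact_mod_cast le_trans (le_max_right _ _) hN
  have hp : (0 : ℝ) ≤ (N : ℝ) ^ g := Real.rpow_nonneg (by linarith) g
  calc gkTail ω₂ lam β γ T N (c * (N : ℝ) ^ 2) ≤ C * (N : ℝ) ^ g := hC N hN₀
    _ ≤ max C 0 * (N : ℝ) ^ g := mul_le_mul_of_nonneg_right (le_max_left _ _) hp
    _ ≤ max C 0 * (N : ℝ) ^ g' :=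
        mul_le_mul_of_nonneg_left (Real.rpow_le_rpow_of_exponent_le hN1 hg) (le_max_right _ _)

/-- **Window ⟹ point: (HSᵂ_b) ⟹ (HSᴾ_{1+2b})** (`V_N(cN²) ≤ C N (cN²)^b = C c^b N^{1+2b}` once `cN² ≥ 1`). [folklore] -/
theorem heatSpreadPoint_of_window {b : ℝ} (hW : HeatSpreadWindow b) : HeatSpreadPoint (1 + 2 * b) := by
  intro ω₂ lam β γ hω hl hβ hγ T hT
  obtain ⟨C, c, hc, N₀, hC⟩ := hW ω₂ lam β γ hω hl hβ hγ T hT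
  obtain ⟨N₁, hN₁⟩ := exists_nat_ge (1 / c)
  refine ⟨max C 0 * c ^ b, c, hc, max N₀ (max N₁ 1), fun N hN => ?_⟩
  have hN₀ : N₀ ≤ N := le_trans (le_max_left _ _) hN
  have hNN₁ : (N₁ : ℝ) ≤ N := by exact_mod_cast le_trans (le_max_left _ _) (le_trans (le_max_right _ _) hN)
  have hN1 : (1 : ℝ) ≤ N := by exact_mod_cast le_trans (le_max_right _ _) (le_trans (le_max_right _ _) hN)
  have hNpos : (0 : ℝ) < N := by linarith
  have ht1 : (1 : ℝ) ≤ c * (N : ℝ) ^ 2 := by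
    have h1 : 1 / c ≤ (N : ℝ) := hN₁.trans hNN₁
    have h2 : 1 ≤ c * (N : ℝ) := by
      rw [div_le_iff₀ hc] at h1; linarith
    nlinarith
  have hV := hC N hN₀ (c * (N : ℝ) ^ 2) ht1 le_rfl
  have hsplit : (c * (N : ℝ) ^ 2) ^ b = c ^ b * (N : ℝ) ^ (2 * b) := by
    rw [Real.mul_rpow hc.le (sq_nonneg _), show ((N : ℝ) ^ 2) = (N : ℝ) ^ (2 : ℝ) from (rpow_two' _).symm,
      ← Real.rpow_mul hNpos.le]
  have hpow : (N : ℝ) * (N : ℝ) ^ (2 * b) = (N : ℝ) ^ (1 + 2 * b) := by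
    rw [Real.rpow_add hNpos, Real.rpow_one]
  have hp : 0 ≤ (N : ℝ) * (c * (N : ℝ) ^ 2) ^ b := by positivity
  calc heatSpread ω₂ lam β γ T N (c * (N : ℝ) ^ 2) ≤ C * (N : ℝ) * (c * (N : ℝ) ^ 2) ^ b := hV
    _ = C * ((N : ℝ) * (c * (N : ℝ) ^ 2) ^ b) := by ring
    _ ≤ max C 0 * ((N : ℝ) * (c * (N : ℝ) ^ 2) ^ b) := mul_le_mul_of_nonneg_right (le_max_left _ _) hp
    _ = max C 0 * c ^ b * ((N : ℝ) * (N : ℝ) ^ (2 * b)) := by rw [hsplit]; ring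
    _ = max C 0 * c ^ b * (N : ℝ) ^ (1 + 2 * b) := by rw [hpow]

/-- (HSᵁ) ⟹ (HSᵂ_1) (any window constant, here `c = 1`). [folklore] -/
theorem heatSpreadWindow_one_of_uniform (hU : HeatSpreadUniform) : HeatSpreadWindow 1 := by
  intro ω₂ lam β γ hω hl hβ hγ T hT
  obtain ⟨C, N₀, hC⟩ := hU ω₂ lam β γ hω hl hβ hγ T hT
  refine ⟨C, 1, one_pos, N₀, fun N hN t ht _ => ?_⟩
  rw [Real.rpow_one]
  exact hC N hN t ht


end Ladder

end Summit.AtomisticToContinuum.FouriersLaw.Theorems.BoundedResponse.HeatSpreading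

end
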